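import Summits.QuantumFields.YangMills.Theorems.F4SubCurvatureDoorShortRootRigiditySliceInClass
import Literature.Analysis.FunctionSpaces.LaplaceFourierMeasure
import Mathlib
import HarnessLib

/-!
# The planar Laplace–Fourier measure of a hexagonal planar-class kernel (budget-free, no boundedness at `0`)

Helper (definition-free) for the by-name rungs of the two registered lines on crux ⟨stmt-QuantumFields-23035⟩
`F4SubCurvatureDoor.ShortRootRigidity`: LINE g19-A «transverse slice» (`Lines/transverse_slice_rung_bounded.lean`:
`BoundedPlanarConstancy`) and LINE g20-A «angular type» (`Lines/angular_type_rungs.lean`: R0 `PlanarFrameTimeHolomorphy`).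

`exists_planarLF`: for every `k ∈ InPlanarClass` (the tree's `…SliceInClassRegistered.InPlanarClass`) there is a positive measure
`μ` on `(E, p) ∈ ℝ × ℝ`, carried by `E ≥ 0`, with `∫ e^{-tE} dμ < ∞` and `k(t, x) = ∫ e^{-tE} cos(px) dμ(E, p)` for all `t > 0`, `x ∈ ℝ`
(the point `(t, x)` is `(WithLp.equiv 2 (Fin 2 → ℝ)).symm ![t, x]`).  This is the tree's Berg–Christensen–Ressel / Glimm–Jaffe theorem
`Literature.Analysis.FunctionSpaces.exists_laplaceFourierMeasure` for `V = ℝ` applied to `(t, x) ↦ k(t, x)`: the planar reflection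
positivity conjunct of `InPlanarClass` and the time reflection `θ₂` give the positivity on the `*`-semigroup `(0,∞) × ℝ`, `(-1) ∘ θ₂` gives
evenness in `x`, continuity off `0` gives continuity in `x` for `t > 0`, and the bound of `|k|` outside the unit disc together with
continuity on the compact segments `[t₀, 1] × {0}` gives the `[t₀, ∞)`-bound.  Neither the budget `‖y‖⁶k → 0` nor boundedness near `0`
is used, so `μ` may be infinite (UV-singular kernels are allowed).  Plus elementary plane-coordinate lemmas.

HONEST LABEL: bookkeeping around an existing tree theorem; nothing about ⟨23035⟩, R2d or any summit is proved by this file.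
-/

noncomputable section

open MeasureTheory Filter Topology Set
open scoped BigOperators

namespace Summit.QuantumFields.YangMills.Theorems.F4SubCurvatureDoorPlanarLaplaceFourier

open Literature.MathematicalPhysics.QuantumLattice (timeReflection timeReflection_apply)
open Summit.QuantumFields.YangMills.Theorems.F4SubCurvatureDoorSliceDensityRegistered (E2)
open Summit.QuantumFields.YangMills.Theorems.F4SubCurvatureDoorSliceInClassRegistered (hexReflection InPlanarClass)

/-! ## Plane coordinates: the point `(t, x) = (WithLp.equiv 2 (Fin 2 → ℝ)).symm ![t, x]` -/

/-- First coordinate of the point `(t, x)`. -/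
theorem mk_apply_zero (t x : ℝ) : ((WithLp.equiv 2 (Fin 2 → ℝ)).symm ![t, x] : E2) 0 = t := by simp

/-- Second coordinate of the point `(t, x)`. -/
theorem mk_apply_one (t x : ℝ) : ((WithLp.equiv 2 (Fin 2 → ℝ)).symm ![t, x] : E2) 1 = x := by simp

/-- Every point of the plane is `(y 0, y 1)`. -/
theorem mk_eta (y : E2) : ((WithLp.equiv 2 (Fin 2 → ℝ)).symm ![y 0, y 1] : E2) = y := by
  ext i
  fin_cases i <;> simp

/-- Extensionality in the plane through the two coordinates. -/
theorem ext2 {y y' : E2} (h0 : y 0 = y' 0) (h1 : y 1 = y' 1) : y = y' := by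
  ext i
  fin_cases i
  · exact h0
  · exact h1

/-- `x ↦ (t, x)` is continuous. -/
theorem continuous_mk (t : ℝ) : Continuous fun x : ℝ => ((WithLp.equiv 2 (Fin 2 → ℝ)).symm ![t, x] : E2) := by
  have h : Continuous fun x : ℝ => (![t, x] : Fin 2 → ℝ) := by
    refine continuous_pi fun i => ?_
    fin_cases i
    · simpa using continuous_const
    · simpa using continuous_id'
  exact (PiLp.continuous_toLp 2 _).comp h

/-- `t ↦ (t, x)` is continuous. -/
theorem continuous_mk_left (x : ℝ) : Continuous fun t : ℝ => ((WithLp.equiv 2 (Fin 2 → ℝ)).symm ![t, x] : E2) := by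
  have h : Continuous fun t : ℝ => (![t, x] : Fin 2 → ℝ) := by
    refine continuous_pi fun i => ?_
    fin_cases i
    · simpa using continuous_id'
    · simpa using continuous_const
  exact (PiLp.continuous_toLp 2 _).comp h

/-- The time reflection `θ₂` on the point `(t, x)` is `(-t, x)`. -/
theorem timeReflection_mk (t x : ℝ) :
    timeReflection 2 ((WithLp.equiv 2 (Fin 2 → ℝ)).symm ![t, x] : E2) = (WithLp.equiv 2 (Fin 2 → ℝ)).symm ![-t, x] := by
  refine ext2 ?_ ?_
  · rw [timeReflection_apply, if_pos rfl, mk_apply_zero, mk_apply_zero]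
  · rw [timeReflection_apply, if_neg (by decide), mk_apply_one, mk_apply_one]

/-- `-(t, x) = (-t, -x)`. -/
theorem neg_mk (t x : ℝ) :
    -((WithLp.equiv 2 (Fin 2 → ℝ)).symm ![t, x] : E2) = (WithLp.equiv 2 (Fin 2 → ℝ)).symm ![-t, -x] := by
  refine ext2 ?_ ?_
  · rw [PiLp.neg_apply, mk_apply_zero, mk_apply_zero]
  · rw [PiLp.neg_apply, mk_apply_one, mk_apply_one]

/-- `(t, x) ≠ 0` when `t ≠ 0`. -/
theorem mk_ne_zero_left {t : ℝ} (x : ℝ) (ht : t ≠ 0) : ((WithLp.equiv 2 (Fin 2 → ℝ)).symm ![t, x] : E2) ≠ 0 := by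
  intro h
  have := congrArg (fun y : E2 => y 0) h
  simp only [mk_apply_zero, PiLp.zero_apply] at this
  exact ht this

/-- `(t, x) ≠ 0` when `x ≠ 0`. -/
theorem mk_ne_zero_right (t : ℝ) {x : ℝ} (hx : x ≠ 0) : ((WithLp.equiv 2 (Fin 2 → ℝ)).symm ![t, x] : E2) ≠ 0 := by
  intro h
  have := congrArg (fun y : E2 => y 1) h
  simp only [mk_apply_one, PiLp.zero_apply] at this
  exact hx this

/-- `|t| ≤ ‖(t, x)‖`. -/
theorem abs_le_norm_mk (t x : ℝ) : |t| ≤ ‖((WithLp.equiv 2 (Fin 2 → ℝ)).symm ![t, x] : E2)‖ := by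
  rw [EuclideanSpace.norm_eq, Fin.sum_univ_two, mk_apply_zero, mk_apply_one, Real.norm_eq_abs, Real.norm_eq_abs,
    ← Real.sqrt_sq_eq_abs t]
  exact Real.sqrt_le_sqrt (by nlinarith [sq_nonneg x, Real.sq_sqrt (sq_nonneg t)])

/-! ## The Laplace–Fourier measure -/

/-- **The planar Laplace–Fourier measure of a hexagonal planar-class kernel** (budget-free; `μ` may be infinite).  For
`k ∈ InPlanarClass` there is a positive measure `μ` on `ℝ × ℝ` with `μ(E < 0) = 0` such that for every `t > 0`:
`∫ e^{-tE} dμ < ∞` and `k(t, x) = ∫ e^{-tE} cos(px) dμ(E, p)` for all `x`. -/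
theorem exists_planarLF (k : E2 → ℝ) (hk : InPlanarClass k) :
    ∃ μ : Measure (ℝ × ℝ), μ (Iio 0 ×ˢ univ) = 0 ∧ ∀ t : ℝ, 0 < t →
      Integrable (fun z : ℝ × ℝ => Real.exp (-(t * z.1))) μ ∧
      ∀ x : ℝ, k ((WithLp.equiv 2 (Fin 2 → ℝ)).symm ![t, x])
        = ∫ z, Real.exp (-(z.1 * t)) * Real.cos (z.2 * x) ∂μ := by
  obtain ⟨hcont, ⟨C, hC⟩, hθ, -, hneg, hRP, -⟩ := hk
  set mk : ℝ → ℝ → E2 := fun t x => (WithLp.equiv 2 (Fin 2 → ℝ)).symm ![t, x] with hmk_def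
  have hmk0 : ∀ t x, mk t x 0 = t := fun t x => mk_apply_zero t x
  have hmk1 : ∀ t x, mk t x 1 = x := fun t x => mk_apply_one t x
  have hθmk : ∀ t x, timeReflection 2 (mk t x) = mk (-t) x := fun t x => timeReflection_mk t x
  have hnegmk : ∀ t x, -(mk t x) = mk (-t) (-x) := fun t x => neg_mk t x
  -- the semigroup kernel
  set kk : ℝ → ℝ → ℝ := fun t x => k (mk t x) with hkk_def
  have hPD : ∀ (m : ℕ) (t : Fin m → ℝ) (z : Fin m → ℝ) (c : Fin m → ℝ), (∀ i, 0 < t i) →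
      0 ≤ ∑ i, ∑ j, c i * c j * kk (t i + t j) (z i - z j) := by
    intro m t z c ht
    have h := hRP m (fun i => mk (t i) (z i)) c (fun i => by rw [hmk0]; exact ht i)
    refine le_of_le_of_eq h (Finset.sum_congr rfl fun i _ => Finset.sum_congr rfl fun j _ => ?_)
    have hpt : timeReflection 2 (mk (t i) (z i)) - mk (t j) (z j) = timeReflection 2 (mk (t i + t j) (z i - z j)) := by
      rw [hθmk, hθmk]
      refine ext2 ?_ ?_
      · rw [PiLp.sub_apply, hmk0, hmk0, hmk0]; ring
      · rw [PiLp.sub_apply, hmk1, hmk1, hmk1]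
    simp only [hkk_def]
    rw [hpt, hθ]
  have heven : ∀ t x, kk t (-x) = kk t x := by
    intro t x
    simp only [hkk_def]
    rw [← hθ (mk t x), hθmk, ← hneg (mk (-t) x), hnegmk, neg_neg]
  have hkcont : ∀ t, 0 < t → Continuous (kk t) := by
    intro t ht
    exact hcont.comp_continuous (continuous_mk t) fun x => mk_ne_zero_left x ht.ne'
  have hbdd : ∀ t₀ : ℝ, 0 < t₀ → ∃ M : ℝ, ∀ t : ℝ, t₀ ≤ t → kk t 0 ≤ M := by
    intro t₀ ht₀
    -- on `[t₀, 1]` by compactness, on `[1, ∞)` by the bound outside the unit disc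
    have hco : ContinuousOn (fun t : ℝ => kk t 0) (Icc t₀ 1) := by
      have h1 : Continuous fun t : {t : ℝ // t ∈ Icc t₀ 1} => kk (t : ℝ) 0 := by
        refine hcont.comp_continuous ((continuous_mk_left 0).comp continuous_subtype_val) fun t => ?_
        exact mk_ne_zero_left 0 (by have := t.2.1; exact fun h => by rw [h] at this; linarith)
      rw [continuousOn_iff_continuous_restrict]
      exact h1
    obtain ⟨M₁, hM₁⟩ := isCompact_Icc.exists_bound_of_continuousOn hco
    refine ⟨max C M₁, fun t ht => ?_⟩
    rcases le_or_gt 1 t with h1 | h1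
    · refine le_trans (le_abs_self _) (le_trans (hC _ ?_) (le_max_left _ _))
      exact le_trans (by rw [abs_of_nonneg (by linarith)]; exact h1) (abs_le_norm_mk t 0)
    · have h := hM₁ t ⟨ht, h1.le⟩
      rw [Real.norm_eq_abs] at h
      exact le_trans (le_abs_self _) (le_trans h (le_max_right _ _))
  obtain ⟨μ, hμsupp, hμ⟩ := Literature.Analysis.FunctionSpaces.exists_laplaceFourierMeasure hPD heven hkcont hbdd
  refine ⟨μ, hμsupp, fun t ht => ⟨(hμ t ht).1, fun x => ?_⟩⟩
  have h := (hμ t ht).2 x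
  simp only [hkk_def] at h
  rw [h]
  refine integral_congr_ae (ae_of_all _ fun z => ?_)
  simp only [RCLike.inner_apply, conj_trivial]
  rw [mul_comm t z.1, mul_comm x z.2]

/-- The carrier condition in the form `μ{E < 0} = 0`. -/
theorem measure_neg_energy_eq_zero {μ : Measure (ℝ × ℝ)} (h : μ (Iio 0 ×ˢ univ) = 0) :
    μ {z : ℝ × ℝ | z.1 < 0} = 0 := by
  have e : {z : ℝ × ℝ | z.1 < 0} = Iio 0 ×ˢ univ := by
    ext z; simp
  rw [e]; exact h

/-- A.e. nonnegativity of the energy. -/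
theorem ae_energy_nonneg {μ : Measure (ℝ × ℝ)} (h : μ (Iio 0 ×ˢ univ) = 0) : ∀ᵐ z ∂μ, 0 ≤ z.1 := by
  rw [ae_iff]
  simpa [not_le] using measure_neg_energy_eq_zero h

end Summit.QuantumFields.YangMills.Theorems.F4SubCurvatureDoorPlanarLaplaceFourier

end
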